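/-
Copyright (c) 2026 the pub-hodgecm-mathlib formalisation cell (harness21).  Prover seat hodgecm-mathlib-K2E1-p03 (g0), Track B ∕ K2-LIT
(build stream 29), h413 = `stmt-HodgeConjecture-24833`, line `K2_E1_TraceFormulaBeta`, socket module «GlobalIndex» §4, file #3 — the payment of
`K2E1TraceFormulaBeta.GlobalIndex.sig_K2E1SquarefreeOneModEightP` TOKEN FOR TOKEN.  2026-09-03.
-/
import Mathlib.NumberTheory.PrimesCongruentOne   -- `Nat.exists_prime_gt_modEq_one` (primes `≡ 1 (mod k)`, cyclotomic-polynomial proof)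
import Mathlib.Algebra.Squarefree.Basic           -- `Prime.squarefree`
import HarnessLib

/-!
# h413 ∕ Track B «K2-LIT», line `K2_E1_TraceFormulaBeta`, socket module «GlobalIndex» §4: A SQUAREFREE `d > 1` WITH `d ≡ 1 (mod 8p)`
# (payment of `Cruxes/H413/Lines/K2_E1_TraceFormulaBetaSigs_GlobalIndex.lean :: sig_K2E1SquarefreeOneModEightP`, statement bytes frozen)

Cell `pub/hodgecm-mathlib`, crux H413 = `stmt-HodgeConjecture-24833`, route of record `HCCMUnconditional`; chair K2-lead (g0), dealer K2E1-plan (g0),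
EMIT «SKELETON LANDED K2E1» (REQUESTS l.72374) file #3 `sig_K2E1SquarefreeOneModEightP` (S–M, elementary) ↦ seat K2E1-p03.
THEOREMS ONLY (no `def`, no `instance`, no `notation`, no named-fact hypothesis, no `sorry`); imports = Mathlib + HarnessLib;
lane `--supports stmt-HodgeConjecture-24833` (count-neutral: first file of the `[L⁺:ℚ] = 1` TRANSPORT package of the line, it does not move 24833).

THE STATEMENT (bytes of the socket).  `∀ p : ℕ, p.Prime → ∃ d : ℕ, 1 < d ∧ Squarefree d ∧ d ≡ 1 [MOD 8 * p]`.

WHY THE LINE WANTS IT (card § «REGIME SPLIT» of `K2_E1_TraceFormulaBeta.md`; not in print).  For such a `d`, `K = ℚ(√d)` is a real quadratic field in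
which `p` and `2` split (`d ≡ 1 (mod p)` is a non-zero square mod `p` for odd `p`; `d ≡ 1 (mod 8)` makes `2` split; for `p = 2` the condition is
`d ≡ 1 (mod 16)`), so for an imaginary quadratic `L` the compositum `L′ = L·K` is a CM field with `[L′⁺:ℚ] = 2` whose local data at a place `v′ ∣ p` of
`L′⁺ = K` are those of `L` at `p` — the device by which the SIMPLE trace formula (pseudo-coefficients at two archimedean places
[Arthur1988InvariantTraceFormulaII §7 Cor. 7.3–7.4]) covers the case `L⁺ = ℚ`.  None of that is asserted here; this file is the elementary input only.

THE PROOF (strategy: a PRIME witness, stronger than asked and the form the transport actually uses).  Mathlib's `Nat.exists_prime_gt_modEq_one`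
(there are arbitrarily large primes `q ≡ 1 (mod k)` for every `k ≠ 0` — the cyclotomic-polynomial special case of Dirichlet's theorem: a prime factor `q` of
`Φ_k(k·n!)` not dividing `k` has `ord_q(k·n!) = k ∣ q − 1`) with `k = 8p ≠ 0` and lower bound `1` gives a prime `q > 1`, `q ≡ 1 (mod 8p)`; a prime is
squarefree (`Prime.squarefree`).  Two declarations:

* §1 `exists_prime_one_lt_modEq_one_eight_mul` · the prime witness `q` (kept as a named theorem: the real quadratic field of the device is `ℚ(√q)`);
* §2 **`SquarefreeOneModEightP`**                · `sig_K2E1SquarefreeOneModEightP` TOKEN FOR TOKEN (tie probe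
      `example : type_of% @SquarefreeOneModEightP = type_of% @K2E1TraceFormulaBeta.GlobalIndex.sig_K2E1SquarefreeOneModEightP := rfl`
      at home once the socket module is built on stream 29: `K2/K2E1-p03/g0/Probe_K2E1SquarefreeOneModEightP.lean`).

WHAT IS NOT HERE.  The splitting of `p` and `2` in `ℚ(√d)` and the base-change∕compositum bookkeeping `L ↦ L·K` (later files of the TRANSPORT package, behind
the line's DEFS leaves); any density statement for squarefree integers in progressions (not needed once the witness is prime).

HONEST LABEL.  HC_CM is proved only modulo the 7 printed citations (2 remaining named inputs: hLiu418 = `stmt-HodgeConjecture-24832`, h413 =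
`stmt-HodgeConjecture-24833`) until rung 0 closes; this file moves no counter.

## References
* [Arthur1988InvariantTraceFormulaII] J. Arthur, *The invariant trace formula II. Global theory*, J. AMS 1 (1988), §7 Cor. 7.3–7.4 (the simple trace
  formula the device feeds; context only).
* [Rogawski1990] J. Rogawski, *Automorphic representations of unitary groups in three variables*, Ann. of Math. Stud. 123 (1990), §13.8 p. 218
  (the regime «fix one infinite place u» the transport serves; context only).
* Mathlib `Mathlib/NumberTheory/PrimesCongruentOne.lean` (`Nat.exists_prime_gt_modEq_one`).
-/

set_option autoImplicit false
-- the mandated namespace repeats the single-problem summit's segment (`HodgeConjecture.HodgeConjecture`)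
set_option linter.dupNamespace false

namespace Summit.HodgeConjecture.HodgeConjecture.Cruxes.H413.K2E1SquarefreeOneModEightP

/-! ## §1 The prime witness -/

/-- **Prime witness.**  For every prime `p` there is a PRIME `q` with `1 < q` and `q ≡ 1 (mod 8p)` — Mathlib's
`Nat.exists_prime_gt_modEq_one` (arbitrarily large primes `≡ 1 (mod k)`, `k ≠ 0`, via cyclotomic polynomials) at `k = 8p`, lower bound `1`.
This is the form the `[L⁺:ℚ] = 1` transport device uses (`K = ℚ(√q)` real quadratic with `p`, `2` split).  [folklore] -/
theorem exists_prime_one_lt_modEq_one_eight_mul (p : ℕ) (hp : p.Prime) :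
    ∃ q : ℕ, q.Prime ∧ 1 < q ∧ q ≡ 1 [MOD 8 * p] :=
  Nat.exists_prime_gt_modEq_one 1 (mul_ne_zero (by norm_num) hp.ne_zero)

/-! ## §2 The socket `sig_K2E1SquarefreeOneModEightP`, token for token -/

/-- **Socket #3 `sig_K2E1SquarefreeOneModEightP` of `Cruxes/H413/Lines/K2_E1_TraceFormulaBetaSigs_GlobalIndex.lean` (statement bytes frozen).**
For every prime `p` there is a squarefree natural number `d > 1` with `d ≡ 1 (mod 8p)`.  Proof: take the prime `q` of
`exists_prime_one_lt_modEq_one_eight_mul`; a prime is squarefree (`Prime.squarefree`).  First (elementary) file of the TRANSPORT package for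
`L⁺ = ℚ` of the line `K2_E1_TraceFormulaBeta` (card § «REGIME SPLIT»; device of the line, not in print).  [folklore] -/
theorem SquarefreeOneModEightP :
    ∀ p : ℕ, p.Prime → ∃ d : ℕ, 1 < d ∧ Squarefree d ∧ d ≡ 1 [MOD 8 * p] := by
  intro p hp
  obtain ⟨q, hq, h1q, hmod⟩ := exists_prime_one_lt_modEq_one_eight_mul p hp
  exact ⟨q, h1q, hq.prime.squarefree, hmod⟩

end Summit.HodgeConjecture.HodgeConjecture.Cruxes.H413.K2E1SquarefreeOneModEightP
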